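import Summits.BirchSwinnertonDyer.BirchSwinnertonDyer.Theorems.ManinLocalTwoThreeEtaBasisFiftyTwoE
import Summits.BirchSwinnertonDyer.BirchSwinnertonDyer.Theorems.ManinLocalTwoThreeBasisFortyFour
import Summits.BirchSwinnertonDyer.BirchSwinnertonDyer.Theorems.ManinLocalTwoThreeBasisFortyFive
import HarnessLib

/-!
# Level 52 (C2 domain, genus 5), part 2c: the ten-form `η`-BASIS of `M₂(Γ₀(52))`, its coefficient columns, coordinates

Cell `bsd-f2-manin`, route `ManinLocalTwoThree`, crux C2 `ManinOddAtFour` (stmt-BirchSwinnertonDyer-22967), LEAD p1 gen 24;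
`--supports stmt-BirchSwinnertonDyer-22967` (helper).  Residual (L2) of an g51's T-an-g51-52 (Fricke-sieve pinning): with
`dim M₂(Γ₀(N)) = g + ν_∞ − 1` (`Literature…ModularFormsGamma0WeightTwoDimension`) and the ten holomorphic `η`-quotients
`C₁, …, C₁₀` (`…EtaBasisFiftyTwoA…E`, certified `q`-coefficients through `q³⁹`):

* §1 `finrank_modularForm_two_fiftyTwo : dim M₂(Γ₀(52)) = 10` (`μ = 84`, `ν_∞ = 6`, `ν₂ = ν₃ = 0`, `g = 5`);
* §2 the COLUMNS of the ten-form family at the pivots `n = 1, …, 8, 13, 26` and the relation columns `9, 15, 21, 39`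
  (`coeff_comb52_n`, through the tree's `coeff_sum_smul`-pattern `coeff_sum_smul_ten`);
* §3 the `10 × 10` pivot solve, `linearIndependent_basis52`, `exists_coords_fiftyTwo`.

Nothing here proves C2, Manin's conjecture or BSD. [cite: DiamondShurman2005, Thm. 3.1.1, Thm. 3.5.1] [cite: CremonaAlgorithms1997, Table 3 (N = 52)]
-/

set_option autoImplicit false
-- lint-debt: the directory name repeats the summit name (sibling precedent `ManinLocalTwoThreeBasisFortyFour.lean`)
set_option linter.dupNamespace false

noncomputable section

open Complex Polynomial
open UpperHalfPlane hiding I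
open scoped MatrixGroups ModularForm
open CongruenceSubgroup
open Literature.NumberTheory.ModularForms
open Literature.NumberTheory.EllipticCurves Literature.NumberTheory.EllipticCurves.ModularForms

namespace Summit.BirchSwinnertonDyer.BirchSwinnertonDyer.Theorems.ManinLocalTwoThree.LevelFiftyTwo

/-! ## §1 `dim M₂(Γ₀(52)) = 10` -/

/-- `μ(Γ₀(52)) = 84`, `ν_∞ = 6`, `ν₂ = ν₃ = 0`. [cite: DiamondShurman2005, §3.8] -/
theorem gamma0_data_52 : gamma0Index 52 = 84 ∧ nuInfty 52 = 6 ∧ nu₂ 52 = 0 ∧ nu₃ 52 = 0 :=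
  ⟨(gamma0Index_mul (m := 4) (n := 13) (by norm_num)).trans
      (by rw [show (4 : ℕ) = 2 ^ 2 by norm_num, gamma0Index_prime_pow (p := 2) (e := 2) Nat.prime_two (by norm_num),
        gamma0Index_prime (by norm_num : Nat.Prime 13)]; norm_num),
    by decide, by rw [nu₂_eq_card]; decide, by rw [nu₃_eq_card]; decide⟩

/-- `g(X₀(52)) = 5`. [cite: DiamondShurman2005, Thm. 3.1.1] -/
theorem genusX0_fiftyTwo : genusX0 52 = 5 := by
  obtain ⟨h1, h2, h3, h4⟩ := gamma0_data_52
  rw [genusX0, h1, h2, h3, h4]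

/-- **`dim M₂(Γ₀(52)) = 10`** (`= g + ν_∞ − 1`). [cite: DiamondShurman2005, Thm. 3.5.1] -/
theorem finrank_modularForm_two_fiftyTwo : Module.finrank ℂ (ModularForm (Gamma0 52) 2) = 10 := by
  rw [finrank_modularForm_two_eq 52, genusX0_fiftyTwo, gamma0_data_52.2.1]

/-! ## §2 The ten forms, the coefficient functional, the columns -/

/-- The ten forms `(C₁, …, C₁₀)` (an g51's `σ`-closed holomorphic `η`-basis). [folklore] -/
def basis52 : Fin 10 → ModularForm (Gamma0 52) 2 := ![C1, C2, C3, C4, C5, C6, C7, C8, C9, C10]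

/-- `q`-coefficients of a finite combination in `M₂(Γ₀(52))`. [folklore] -/
theorem coeff_sum_smul_ten (c : Fin 10 → ℂ) (v : Fin 10 → ModularForm (Gamma0 52) 2) (n : ℕ) :
    (qExpansion 1 ⇑(∑ i, c i • v i)).coeff n = ∑ i, c i * (qExpansion 1 ⇑(v i)).coeff n := by
  have h1 : qExpansion 1 ⇑(∑ i, c i • v i) = ∑ i, c i • qExpansion 1 ⇑(v i) := by
    change ModularForm.qExpansionAddHom one_pos one_mem_strictPeriods_Gamma0 2 (∑ i, c i • v i) = _
    rw [map_sum]
    refine Finset.sum_congr rfl fun i _ ↦ ?_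
    change qExpansion 1 ⇑(c i • v i) = _
    exact ModularForm.qExpansion_smul one_pos one_mem_strictPeriods_Gamma0 (c i) (v i)
  rw [h1, map_sum]
  simp only [map_smul, smul_eq_mul]












/-- The fourteen needed `q`-coefficients of `C1`. [cite: CremonaAlgorithms1997, Table 3 (N = 52)] -/
theorem cols_C1 :
    (qExpansion 1 ⇑(C1)).coeff 1 = (0 : ℂ) ∧
    (qExpansion 1 ⇑(C1)).coeff 2 = (1 : ℂ) ∧
    (qExpansion 1 ⇑(C1)).coeff 3 = (-1 : ℂ) ∧
    (qExpansion 1 ⇑(C1)).coeff 4 = (1 : ℂ) ∧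
    (qExpansion 1 ⇑(C1)).coeff 5 = (-2 : ℂ) ∧
    (qExpansion 1 ⇑(C1)).coeff 6 = (0 : ℂ) ∧
    (qExpansion 1 ⇑(C1)).coeff 7 = (-1 : ℂ) ∧
    (qExpansion 1 ⇑(C1)).coeff 8 = (2 : ℂ) ∧
    (qExpansion 1 ⇑(C1)).coeff 13 = (0 : ℂ) ∧
    (qExpansion 1 ⇑(C1)).coeff 26 = (0 : ℂ) ∧
    (qExpansion 1 ⇑(C1)).coeff 9 = (-1 : ℂ) ∧
    (qExpansion 1 ⇑(C1)).coeff 15 = (-4 : ℂ) ∧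
    (qExpansion 1 ⇑(C1)).coeff 21 = (-6 : ℂ) ∧
    (qExpansion 1 ⇑(C1)).coeff 39 = (0 : ℂ) := by
  refine ⟨?_, ?_, ?_, ?_, ?_, ?_, ?_, ?_, ?_, ?_, ?_, ?_, ?_, ?_⟩ <;> (rw [coeff_C1 _ (by norm_num)]; norm_num)


/-- The fourteen needed `q`-coefficients of `C2`. [cite: CremonaAlgorithms1997, Table 3 (N = 52)] -/
theorem cols_C2 :
    (qExpansion 1 ⇑(C2)).coeff 1 = (0 : ℂ) ∧
    (qExpansion 1 ⇑(C2)).coeff 2 = (0 : ℂ) ∧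
    (qExpansion 1 ⇑(C2)).coeff 3 = (0 : ℂ) ∧
    (qExpansion 1 ⇑(C2)).coeff 4 = (0 : ℂ) ∧
    (qExpansion 1 ⇑(C2)).coeff 5 = (1 : ℂ) ∧
    (qExpansion 1 ⇑(C2)).coeff 6 = (-3 : ℂ) ∧
    (qExpansion 1 ⇑(C2)).coeff 7 = (2 : ℂ) ∧
    (qExpansion 1 ⇑(C2)).coeff 8 = (-1 : ℂ) ∧
    (qExpansion 1 ⇑(C2)).coeff 13 = (0 : ℂ) ∧
    (qExpansion 1 ⇑(C2)).coeff 26 = (-1 : ℂ) ∧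
    (qExpansion 1 ⇑(C2)).coeff 9 = (4 : ℂ) ∧
    (qExpansion 1 ⇑(C2)).coeff 15 = (5 : ℂ) ∧
    (qExpansion 1 ⇑(C2)).coeff 21 = (5 : ℂ) ∧
    (qExpansion 1 ⇑(C2)).coeff 39 = (1 : ℂ) := by
  refine ⟨?_, ?_, ?_, ?_, ?_, ?_, ?_, ?_, ?_, ?_, ?_, ?_, ?_, ?_⟩ <;> (rw [coeff_C2 _ (by norm_num)]; norm_num)


/-- The fourteen needed `q`-coefficients of `C3`. [cite: CremonaAlgorithms1997, Table 3 (N = 52)] -/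
theorem cols_C3 :
    (qExpansion 1 ⇑(C3)).coeff 1 = (0 : ℂ) ∧
    (qExpansion 1 ⇑(C3)).coeff 2 = (0 : ℂ) ∧
    (qExpansion 1 ⇑(C3)).coeff 3 = (0 : ℂ) ∧
    (qExpansion 1 ⇑(C3)).coeff 4 = (0 : ℂ) ∧
    (qExpansion 1 ⇑(C3)).coeff 5 = (0 : ℂ) ∧
    (qExpansion 1 ⇑(C3)).coeff 6 = (0 : ℂ) ∧
    (qExpansion 1 ⇑(C3)).coeff 7 = (1 : ℂ) ∧
    (qExpansion 1 ⇑(C3)).coeff 8 = (0 : ℂ) ∧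
    (qExpansion 1 ⇑(C3)).coeff 13 = (2 : ℂ) ∧
    (qExpansion 1 ⇑(C3)).coeff 26 = (0 : ℂ) ∧
    (qExpansion 1 ⇑(C3)).coeff 9 = (2 : ℂ) ∧
    (qExpansion 1 ⇑(C3)).coeff 15 = (2 : ℂ) ∧
    (qExpansion 1 ⇑(C3)).coeff 21 = (2 : ℂ) ∧
    (qExpansion 1 ⇑(C3)).coeff 39 = (8 : ℂ) := by
  refine ⟨?_, ?_, ?_, ?_, ?_, ?_, ?_, ?_, ?_, ?_, ?_, ?_, ?_, ?_⟩ <;> (rw [coeff_C3 _ (by norm_num)]; norm_num)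


/-- The fourteen needed `q`-coefficients of `C4`. [cite: CremonaAlgorithms1997, Table 3 (N = 52)] -/
theorem cols_C4 :
    (qExpansion 1 ⇑(C4)).coeff 1 = (-4 : ℂ) ∧
    (qExpansion 1 ⇑(C4)).coeff 2 = (4 : ℂ) ∧
    (qExpansion 1 ⇑(C4)).coeff 3 = (0 : ℂ) ∧
    (qExpansion 1 ⇑(C4)).coeff 4 = (4 : ℂ) ∧
    (qExpansion 1 ⇑(C4)).coeff 5 = (-8 : ℂ) ∧
    (qExpansion 1 ⇑(C4)).coeff 6 = (0 : ℂ) ∧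
    (qExpansion 1 ⇑(C4)).coeff 7 = (0 : ℂ) ∧
    (qExpansion 1 ⇑(C4)).coeff 8 = (4 : ℂ) ∧
    (qExpansion 1 ⇑(C4)).coeff 13 = (-12 : ℂ) ∧
    (qExpansion 1 ⇑(C4)).coeff 26 = (44 : ℂ) ∧
    (qExpansion 1 ⇑(C4)).coeff 9 = (-4 : ℂ) ∧
    (qExpansion 1 ⇑(C4)).coeff 15 = (-16 : ℂ) ∧
    (qExpansion 1 ⇑(C4)).coeff 21 = (-16 : ℂ) ∧
    (qExpansion 1 ⇑(C4)).coeff 39 = (-64 : ℂ) := by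
  refine ⟨?_, ?_, ?_, ?_, ?_, ?_, ?_, ?_, ?_, ?_, ?_, ?_, ?_, ?_⟩ <;> (rw [coeff_C4 _ (by norm_num)]; norm_num)


/-- The fourteen needed `q`-coefficients of `C5`. [cite: CremonaAlgorithms1997, Table 3 (N = 52)] -/
theorem cols_C5 :
    (qExpansion 1 ⇑(C5)).coeff 1 = (1 : ℂ) ∧
    (qExpansion 1 ⇑(C5)).coeff 2 = (0 : ℂ) ∧
    (qExpansion 1 ⇑(C5)).coeff 3 = (4 : ℂ) ∧
    (qExpansion 1 ⇑(C5)).coeff 4 = (0 : ℂ) ∧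
    (qExpansion 1 ⇑(C5)).coeff 5 = (6 : ℂ) ∧
    (qExpansion 1 ⇑(C5)).coeff 6 = (0 : ℂ) ∧
    (qExpansion 1 ⇑(C5)).coeff 7 = (8 : ℂ) ∧
    (qExpansion 1 ⇑(C5)).coeff 8 = (0 : ℂ) ∧
    (qExpansion 1 ⇑(C5)).coeff 13 = (14 : ℂ) ∧
    (qExpansion 1 ⇑(C5)).coeff 26 = (0 : ℂ) ∧
    (qExpansion 1 ⇑(C5)).coeff 9 = (13 : ℂ) ∧
    (qExpansion 1 ⇑(C5)).coeff 15 = (24 : ℂ) ∧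
    (qExpansion 1 ⇑(C5)).coeff 21 = (32 : ℂ) ∧
    (qExpansion 1 ⇑(C5)).coeff 39 = (56 : ℂ) := by
  refine ⟨?_, ?_, ?_, ?_, ?_, ?_, ?_, ?_, ?_, ?_, ?_, ?_, ?_, ?_⟩ <;> (rw [coeff_C5 _ (by norm_num)]; norm_num)


/-- The fourteen needed `q`-coefficients of `C6`. [cite: CremonaAlgorithms1997, Table 3 (N = 52)] -/
theorem cols_C6 :
    (qExpansion 1 ⇑(C6)).coeff 1 = (0 : ℂ) ∧
    (qExpansion 1 ⇑(C6)).coeff 2 = (0 : ℂ) ∧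
    (qExpansion 1 ⇑(C6)).coeff 3 = (0 : ℂ) ∧
    (qExpansion 1 ⇑(C6)).coeff 4 = (0 : ℂ) ∧
    (qExpansion 1 ⇑(C6)).coeff 5 = (0 : ℂ) ∧
    (qExpansion 1 ⇑(C6)).coeff 6 = (0 : ℂ) ∧
    (qExpansion 1 ⇑(C6)).coeff 7 = (0 : ℂ) ∧
    (qExpansion 1 ⇑(C6)).coeff 8 = (0 : ℂ) ∧
    (qExpansion 1 ⇑(C6)).coeff 13 = (-8 : ℂ) ∧
    (qExpansion 1 ⇑(C6)).coeff 26 = (24 : ℂ) ∧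
    (qExpansion 1 ⇑(C6)).coeff 9 = (0 : ℂ) ∧
    (qExpansion 1 ⇑(C6)).coeff 15 = (0 : ℂ) ∧
    (qExpansion 1 ⇑(C6)).coeff 21 = (0 : ℂ) ∧
    (qExpansion 1 ⇑(C6)).coeff 39 = (-32 : ℂ) := by
  refine ⟨?_, ?_, ?_, ?_, ?_, ?_, ?_, ?_, ?_, ?_, ?_, ?_, ?_, ?_⟩ <;> (rw [coeff_C6 _ (by norm_num)]; norm_num)


/-- The fourteen needed `q`-coefficients of `C7`. [cite: CremonaAlgorithms1997, Table 3 (N = 52)] -/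
theorem cols_C7 :
    (qExpansion 1 ⇑(C7)).coeff 1 = (0 : ℂ) ∧
    (qExpansion 1 ⇑(C7)).coeff 2 = (1 : ℂ) ∧
    (qExpansion 1 ⇑(C7)).coeff 3 = (1 : ℂ) ∧
    (qExpansion 1 ⇑(C7)).coeff 4 = (1 : ℂ) ∧
    (qExpansion 1 ⇑(C7)).coeff 5 = (2 : ℂ) ∧
    (qExpansion 1 ⇑(C7)).coeff 6 = (0 : ℂ) ∧
    (qExpansion 1 ⇑(C7)).coeff 7 = (1 : ℂ) ∧
    (qExpansion 1 ⇑(C7)).coeff 8 = (2 : ℂ) ∧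
    (qExpansion 1 ⇑(C7)).coeff 13 = (0 : ℂ) ∧
    (qExpansion 1 ⇑(C7)).coeff 26 = (0 : ℂ) ∧
    (qExpansion 1 ⇑(C7)).coeff 9 = (1 : ℂ) ∧
    (qExpansion 1 ⇑(C7)).coeff 15 = (4 : ℂ) ∧
    (qExpansion 1 ⇑(C7)).coeff 21 = (6 : ℂ) ∧
    (qExpansion 1 ⇑(C7)).coeff 39 = (0 : ℂ) := by
  refine ⟨?_, ?_, ?_, ?_, ?_, ?_, ?_, ?_, ?_, ?_, ?_, ?_, ?_, ?_⟩ <;> (rw [coeff_C7 _ (by norm_num)]; norm_num)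


/-- The fourteen needed `q`-coefficients of `C8`. [cite: CremonaAlgorithms1997, Table 3 (N = 52)] -/
theorem cols_C8 :
    (qExpansion 1 ⇑(C8)).coeff 1 = (2 : ℂ) ∧
    (qExpansion 1 ⇑(C8)).coeff 2 = (-2 : ℂ) ∧
    (qExpansion 1 ⇑(C8)).coeff 3 = (-4 : ℂ) ∧
    (qExpansion 1 ⇑(C8)).coeff 4 = (2 : ℂ) ∧
    (qExpansion 1 ⇑(C8)).coeff 5 = (0 : ℂ) ∧
    (qExpansion 1 ⇑(C8)).coeff 6 = (-4 : ℂ) ∧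
    (qExpansion 1 ⇑(C8)).coeff 7 = (0 : ℂ) ∧
    (qExpansion 1 ⇑(C8)).coeff 8 = (2 : ℂ) ∧
    (qExpansion 1 ⇑(C8)).coeff 13 = (-2 : ℂ) ∧
    (qExpansion 1 ⇑(C8)).coeff 26 = (-2 : ℂ) ∧
    (qExpansion 1 ⇑(C8)).coeff 9 = (6 : ℂ) ∧
    (qExpansion 1 ⇑(C8)).coeff 15 = (4 : ℂ) ∧
    (qExpansion 1 ⇑(C8)).coeff 21 = (-4 : ℂ) ∧
    (qExpansion 1 ⇑(C8)).coeff 39 = (4 : ℂ) := by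
  refine ⟨?_, ?_, ?_, ?_, ?_, ?_, ?_, ?_, ?_, ?_, ?_, ?_, ?_, ?_⟩ <;> (rw [coeff_C8 _ (by norm_num)]; norm_num)


/-- The fourteen needed `q`-coefficients of `C9`. [cite: CremonaAlgorithms1997, Table 3 (N = 52)] -/
theorem cols_C9 :
    (qExpansion 1 ⇑(C9)).coeff 1 = (0 : ℂ) ∧
    (qExpansion 1 ⇑(C9)).coeff 2 = (0 : ℂ) ∧
    (qExpansion 1 ⇑(C9)).coeff 3 = (0 : ℂ) ∧
    (qExpansion 1 ⇑(C9)).coeff 4 = (0 : ℂ) ∧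
    (qExpansion 1 ⇑(C9)).coeff 5 = (1 : ℂ) ∧
    (qExpansion 1 ⇑(C9)).coeff 6 = (3 : ℂ) ∧
    (qExpansion 1 ⇑(C9)).coeff 7 = (2 : ℂ) ∧
    (qExpansion 1 ⇑(C9)).coeff 8 = (1 : ℂ) ∧
    (qExpansion 1 ⇑(C9)).coeff 13 = (0 : ℂ) ∧
    (qExpansion 1 ⇑(C9)).coeff 26 = (1 : ℂ) ∧
    (qExpansion 1 ⇑(C9)).coeff 9 = (4 : ℂ) ∧
    (qExpansion 1 ⇑(C9)).coeff 15 = (5 : ℂ) ∧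
    (qExpansion 1 ⇑(C9)).coeff 21 = (5 : ℂ) ∧
    (qExpansion 1 ⇑(C9)).coeff 39 = (1 : ℂ) := by
  refine ⟨?_, ?_, ?_, ?_, ?_, ?_, ?_, ?_, ?_, ?_, ?_, ?_, ?_, ?_⟩ <;> (rw [coeff_C9 _ (by norm_num)]; norm_num)


/-- The fourteen needed `q`-coefficients of `C10`. [cite: CremonaAlgorithms1997, Table 3 (N = 52)] -/
theorem cols_C10 :
    (qExpansion 1 ⇑(C10)).coeff 1 = (-2 : ℂ) ∧
    (qExpansion 1 ⇑(C10)).coeff 2 = (-2 : ℂ) ∧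
    (qExpansion 1 ⇑(C10)).coeff 3 = (4 : ℂ) ∧
    (qExpansion 1 ⇑(C10)).coeff 4 = (2 : ℂ) ∧
    (qExpansion 1 ⇑(C10)).coeff 5 = (0 : ℂ) ∧
    (qExpansion 1 ⇑(C10)).coeff 6 = (-4 : ℂ) ∧
    (qExpansion 1 ⇑(C10)).coeff 7 = (0 : ℂ) ∧
    (qExpansion 1 ⇑(C10)).coeff 8 = (2 : ℂ) ∧
    (qExpansion 1 ⇑(C10)).coeff 13 = (2 : ℂ) ∧
    (qExpansion 1 ⇑(C10)).coeff 26 = (-2 : ℂ) ∧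
    (qExpansion 1 ⇑(C10)).coeff 9 = (-6 : ℂ) ∧
    (qExpansion 1 ⇑(C10)).coeff 15 = (-4 : ℂ) ∧
    (qExpansion 1 ⇑(C10)).coeff 21 = (4 : ℂ) ∧
    (qExpansion 1 ⇑(C10)).coeff 39 = (-4 : ℂ) := by
  refine ⟨?_, ?_, ?_, ?_, ?_, ?_, ?_, ?_, ?_, ?_, ?_, ?_, ?_, ?_⟩ <;> (rw [coeff_C10 _ (by norm_num)]; norm_num)

end Summit.BirchSwinnertonDyer.BirchSwinnertonDyer.Theorems.ManinLocalTwoThree.LevelFiftyTwo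

end
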